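import Summits.Ventures.PercRepro.RankLevelSetRuleQCellFourRow

/-!
# PercRepro — THE SUPPORTING-LINE AND JENSEN BOUNDS ON THE THIRD SLICE SUM `S₃`
(p4, gen 21; paper proofs/P4-CELL-THREE.md §7.5 — the tool of record for the cell families `k ≥ 5`)

With `T_a = C(m, a)/C(q+1+a, a+1)` and `w(a) = (a+2)/(q+a+2)`: `S₂ = Σ T_a·w(a)` and `S₃ = Σ T_a·ψ(w(a))` for the
convex `ψ(w) = w(1 + (q−1)w)/(q+1−w) = (q+1)q²/(q+1−w) + (q−1)(q+1−w) − (2q²−1)`. The supporting line of `ψ` at any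
`r < q+1` (`sliceThree_term_at`: the remainder is `(q+1)q²(w−r)²/((q+1−w)(q+1−r)²) ≥ 0`) gives
`ψ(r)·S₁ + ψ'(r)·(S₂ − r·S₁) ≤ S₃` (`sliceThree_ge_line`), and at the mean `r = S₂/S₁` Jensen's inequality
`S₁·ψ(S₂/S₁) ≤ S₃` (`sliceThree_ge_jensen`). CellFourRow's `sliceThree_ge` is the case `r = w(0) = 2/(q+2)`.
Axioms: standard.
-/

namespace PercRepro

open Finset

/-- `1/C(q+3+a, a+3) = ψ(w)/C(q+1+a, a+1)` with `w = (a+2)/(q+a+2)`: explicitly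
`1/C(q+3+a, a+3) = (a+2)(a+3)/((q+a+2)(q+a+3)) · 1/C(q+1+a, a+1)`. -/
lemma one_div_choose_three_eq (q a : ℕ) :
    (1 : ℚ) / ((q + 3 + a).choose (a + 3) : ℚ)
      = ((a : ℚ) + 2) * ((a : ℚ) + 3) / (((q : ℚ) + a + 2) * ((q : ℚ) + a + 3)) * (1 / ((q + 1 + a).choose (a + 1) : ℚ)) := by
  have hX : (0 : ℚ) < (q + 1 + a).choose (a + 1) := by exact_mod_cast Nat.choose_pos (by omega)
  have hY : (0 : ℚ) < (q + 2 + a).choose (a + 2) := by exact_mod_cast Nat.choose_pos (by omega)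
  have hZ : (0 : ℚ) < (q + 3 + a).choose (a + 3) := by exact_mod_cast Nat.choose_pos (by omega)
  have hXY : ((q : ℚ) + 2 + a) * ((q + 1 + a).choose (a + 1) : ℚ) = ((q + 2 + a).choose (a + 2) : ℚ) * (a + 2) := by
    have h := Nat.add_one_mul_choose_eq (q + 1 + a) (a + 1)
    rw [show q + 1 + a + 1 = q + 2 + a by ring, show a + 1 + 1 = a + 2 by ring] at h
    exact_mod_cast h
  have hYZ : ((q : ℚ) + 3 + a) * ((q + 2 + a).choose (a + 2) : ℚ) = ((q + 3 + a).choose (a + 3) : ℚ) * (a + 3) := by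
    have h := Nat.add_one_mul_choose_eq (q + 2 + a) (a + 2)
    rw [show q + 2 + a + 1 = q + 3 + a by ring, show a + 2 + 1 = a + 3 by ring] at h
    exact_mod_cast h
  rw [div_mul_div_comm, mul_one, div_eq_div_iff hZ.ne' (by positivity)]
  linear_combination ((a : ℚ) + 2) * hYZ + ((q : ℚ) + 3 + a) * hXY

/-- `1/C(q+2+a, a+2) = w/C(q+1+a, a+1)` with `w = (a+2)/(q+a+2)`. -/
lemma one_div_choose_two_eq (q a : ℕ) :
    (1 : ℚ) / ((q + 2 + a).choose (a + 2) : ℚ)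
      = ((a : ℚ) + 2) / ((q : ℚ) + a + 2) * (1 / ((q + 1 + a).choose (a + 1) : ℚ)) := by
  have hX : (0 : ℚ) < (q + 1 + a).choose (a + 1) := by exact_mod_cast Nat.choose_pos (by omega)
  have hY : (0 : ℚ) < (q + 2 + a).choose (a + 2) := by exact_mod_cast Nat.choose_pos (by omega)
  have hXY : ((q : ℚ) + 2 + a) * ((q + 1 + a).choose (a + 1) : ℚ) = ((q + 2 + a).choose (a + 2) : ℚ) * (a + 2) := by
    have h := Nat.add_one_mul_choose_eq (q + 1 + a) (a + 1)
    rw [show q + 1 + a + 1 = q + 2 + a by ring, show a + 1 + 1 = a + 2 by ring] at h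
    exact_mod_cast h
  rw [div_mul_div_comm, mul_one, div_eq_div_iff hY.ne' (by positivity)]
  linear_combination hXY

/-- **The supporting line of `ψ` at `r`, termwise**: for `r < q + 1` and `w = (a+2)/(q+a+2)`,
`(ψ(r) + ψ'(r)·(w − r))/C(q+1+a, a+1) ≤ 1/C(q+3+a, a+3)`, where `ψ(r) = r(1+(q−1)r)/(q+1−r)` and
`ψ'(r) = (q+1)q²/(q+1−r)² − (q−1)`; the remainder is `(q+1)q²(w−r)²/((q+1−w)(q+1−r)²)`. -/
lemma sliceThree_term_at (q a : ℕ) (hq : 1 ≤ q) (r : ℚ) (hr : r < q + 1) :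
    (r * (1 + ((q : ℚ) - 1) * r) / ((q : ℚ) + 1 - r)
        + (((q : ℚ) + 1) * (q : ℚ) ^ 2 / ((q : ℚ) + 1 - r) ^ 2 - ((q : ℚ) - 1))
          * (((a : ℚ) + 2) / ((q : ℚ) + a + 2) - r))
      * (1 / ((q + 1 + a).choose (a + 1) : ℚ))
      ≤ 1 / ((q + 3 + a).choose (a + 3) : ℚ) := by
  rw [one_div_choose_three_eq]
  have hX : (0 : ℚ) < 1 / ((q + 1 + a).choose (a + 1) : ℚ) := by
    have : (0 : ℚ) < (q + 1 + a).choose (a + 1) := by exact_mod_cast Nat.choose_pos (by omega)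
    positivity
  refine mul_le_mul_of_nonneg_right ?_ hX.le
  -- `ψ(w) − ψ(r) − ψ'(r)(w − r) = (q+1)q²(w−r)²/((q+1−w)(q+1−r)²)` with `w = (a+2)/(q+a+2)`, `q+1−w = q(q+a+3)/(q+a+2)`
  have hq' : (0 : ℚ) < q := by exact_mod_cast hq
  have hqr : (0 : ℚ) < (q : ℚ) + 1 - r := by linarith
  have hqa2 : (0 : ℚ) < (q : ℚ) + a + 2 := by positivity
  have hqa3 : (0 : ℚ) < (q : ℚ) + a + 3 := by positivity
  set w : ℚ := ((a : ℚ) + 2) / ((q : ℚ) + a + 2) with hw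
  have hw' : w * ((q : ℚ) + a + 2) = (a : ℚ) + 2 := by rw [hw]; exact div_mul_cancel₀ _ hqa2.ne'
  have hw1 : (q : ℚ) + 1 - w = (q : ℚ) * ((q : ℚ) + a + 3) / ((q : ℚ) + a + 2) := by
    rw [eq_div_iff hqa2.ne']; linear_combination (-1 : ℚ) * hw'
  have hw2 : (0 : ℚ) < (q : ℚ) + 1 - w := by rw [hw1]; exact div_pos (mul_pos hq' hqa3) hqa2
  have e1 : 1 + ((q : ℚ) - 1) * w = (q : ℚ) * ((a : ℚ) + 3) / ((q : ℚ) + a + 2) := by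
    rw [eq_div_iff hqa2.ne']; linear_combination ((q : ℚ) - 1) * hw'
  -- the target in terms of `w`: `(a+2)(a+3)/((q+a+2)(q+a+3)) = ψ(w)`
  have hpsi : ((a : ℚ) + 2) * ((a : ℚ) + 3) / (((q : ℚ) + a + 2) * ((q : ℚ) + a + 3))
      = w * (1 + ((q : ℚ) - 1) * w) / ((q : ℚ) + 1 - w) := by
    have h0 : (q : ℚ) ≠ 0 := hq'.ne'
    have h2 : (q : ℚ) + a + 2 ≠ 0 := hqa2.ne'
    have h3 : (q : ℚ) + a + 3 ≠ 0 := hqa3.ne'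
    rw [hw1, e1, hw]
    field_simp
  rw [hpsi]
  have key : w * (1 + ((q : ℚ) - 1) * w) / ((q : ℚ) + 1 - w)
      - (r * (1 + ((q : ℚ) - 1) * r) / ((q : ℚ) + 1 - r)
        + (((q : ℚ) + 1) * (q : ℚ) ^ 2 / ((q : ℚ) + 1 - r) ^ 2 - ((q : ℚ) - 1)) * (w - r))
      = ((q : ℚ) + 1) * (q : ℚ) ^ 2 * (w - r) ^ 2 / (((q : ℚ) + 1 - w) * ((q : ℚ) + 1 - r) ^ 2) := by
    have h1 : (q : ℚ) + 1 - w ≠ 0 := hw2.ne'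
    have h2 : (q : ℚ) + 1 - r ≠ 0 := hqr.ne'
    field_simp
    ring
  have hnn : (0 : ℚ) ≤ ((q : ℚ) + 1) * (q : ℚ) ^ 2 * (w - r) ^ 2 / (((q : ℚ) + 1 - w) * ((q : ℚ) + 1 - r) ^ 2) := by
    exact div_nonneg (by positivity) (mul_pos hw2 (pow_pos hqr 2)).le
  linarith [key, hnn]

/-- **The supporting-line bound on `S₃`** at any `r < q + 1`:
`ψ(r)·S₁ + ψ'(r)·(S₂ − r·S₁) ≤ S₃`. -/
lemma sliceThree_ge_line (q m : ℕ) (hq : 1 ≤ q) (r : ℚ) (hr : r < q + 1) :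
    r * (1 + ((q : ℚ) - 1) * r) / ((q : ℚ) + 1 - r)
        * ∑ a ∈ range (m + 1), (m.choose a : ℚ) / ((q + 1 + a).choose (a + 1) : ℚ)
      + (((q : ℚ) + 1) * (q : ℚ) ^ 2 / ((q : ℚ) + 1 - r) ^ 2 - ((q : ℚ) - 1))
        * (∑ a ∈ range (m + 1), (m.choose a : ℚ) / ((q + 2 + a).choose (a + 2) : ℚ)
            - r * ∑ a ∈ range (m + 1), (m.choose a : ℚ) / ((q + 1 + a).choose (a + 1) : ℚ))
      ≤ ∑ a ∈ range (m + 1), (m.choose a : ℚ) / ((q + 3 + a).choose (a + 3) : ℚ) := by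
  rw [Finset.mul_sum, Finset.mul_sum, ← Finset.sum_sub_distrib, Finset.mul_sum, ← Finset.sum_add_distrib]
  refine Finset.sum_le_sum (fun a _ => ?_)
  have h := sliceThree_term_at q a hq r hr
  have hw : (0 : ℚ) ≤ m.choose a := by positivity
  have h2 := one_div_choose_two_eq q a
  calc r * (1 + ((q : ℚ) - 1) * r) / ((q : ℚ) + 1 - r) * ((m.choose a : ℚ) / ((q + 1 + a).choose (a + 1) : ℚ))
        + (((q : ℚ) + 1) * (q : ℚ) ^ 2 / ((q : ℚ) + 1 - r) ^ 2 - ((q : ℚ) - 1))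
          * ((m.choose a : ℚ) / ((q + 2 + a).choose (a + 2) : ℚ)
            - r * ((m.choose a : ℚ) / ((q + 1 + a).choose (a + 1) : ℚ)))
      = (m.choose a : ℚ) * ((r * (1 + ((q : ℚ) - 1) * r) / ((q : ℚ) + 1 - r)
          + (((q : ℚ) + 1) * (q : ℚ) ^ 2 / ((q : ℚ) + 1 - r) ^ 2 - ((q : ℚ) - 1))
            * (((a : ℚ) + 2) / ((q : ℚ) + a + 2) - r)) * (1 / ((q + 1 + a).choose (a + 1) : ℚ))) := by
        have e : (m.choose a : ℚ) / ((q + 2 + a).choose (a + 2) : ℚ)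
            = (m.choose a : ℚ) * (((a : ℚ) + 2) / ((q : ℚ) + a + 2) * (1 / ((q + 1 + a).choose (a + 1) : ℚ))) := by
          rw [← h2]; ring
        rw [e]; ring
    _ ≤ (m.choose a : ℚ) * (1 / ((q + 3 + a).choose (a + 3) : ℚ)) := mul_le_mul_of_nonneg_left h hw
    _ = (m.choose a : ℚ) / ((q + 3 + a).choose (a + 3) : ℚ) := by ring

/-- `S₂ ≤ S₁` (termwise `w(a) < 1`). -/
lemma sliceTwo_le_sliceOne (q m : ℕ) :
    ∑ a ∈ range (m + 1), (m.choose a : ℚ) / ((q + 2 + a).choose (a + 2) : ℚ)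
      ≤ ∑ a ∈ range (m + 1), (m.choose a : ℚ) / ((q + 1 + a).choose (a + 1) : ℚ) := by
  refine Finset.sum_le_sum (fun a _ => ?_)
  have hX : (0 : ℚ) < (q + 1 + a).choose (a + 1) := by exact_mod_cast Nat.choose_pos (by omega)
  apply div_le_div_of_nonneg_left (by positivity) hX
  have hXY : ((q : ℚ) + 2 + a) * ((q + 1 + a).choose (a + 1) : ℚ) = ((q + 2 + a).choose (a + 2) : ℚ) * (a + 2) := by
    have h := Nat.add_one_mul_choose_eq (q + 1 + a) (a + 1)
    rw [show q + 1 + a + 1 = q + 2 + a by ring, show a + 1 + 1 = a + 2 by ring] at h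
    exact_mod_cast h
  have e : (((q + 2 + a).choose (a + 2) : ℚ) - ((q + 1 + a).choose (a + 1) : ℚ)) * ((a : ℚ) + 2)
      = (q : ℚ) * ((q + 1 + a).choose (a + 1) : ℚ) := by linear_combination (-1 : ℚ) * hXY
  have : (0 : ℚ) ≤ (((q + 2 + a).choose (a + 2) : ℚ) - ((q + 1 + a).choose (a + 1) : ℚ)) * ((a : ℚ) + 2) := by
    rw [e]; positivity
  have := nonneg_of_mul_nonneg_left this (by positivity)
  linarith

/-- **Jensen's inequality for `S₃`**: `S₁·ψ(S₂/S₁) ≤ S₃` with `ψ(r) = r(1+(q−1)r)/(q+1−r)` — the supporting line at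
the mean `r = S₂/S₁`. -/
theorem sliceThree_ge_jensen (q m : ℕ) (hq : 1 ≤ q) :
    (∑ a ∈ range (m + 1), (m.choose a : ℚ) / ((q + 1 + a).choose (a + 1) : ℚ))
        * ((∑ a ∈ range (m + 1), (m.choose a : ℚ) / ((q + 2 + a).choose (a + 2) : ℚ))
            / (∑ a ∈ range (m + 1), (m.choose a : ℚ) / ((q + 1 + a).choose (a + 1) : ℚ))
          * (1 + ((q : ℚ) - 1) * ((∑ a ∈ range (m + 1), (m.choose a : ℚ) / ((q + 2 + a).choose (a + 2) : ℚ))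
            / (∑ a ∈ range (m + 1), (m.choose a : ℚ) / ((q + 1 + a).choose (a + 1) : ℚ))))
          / ((q : ℚ) + 1 - (∑ a ∈ range (m + 1), (m.choose a : ℚ) / ((q + 2 + a).choose (a + 2) : ℚ))
            / (∑ a ∈ range (m + 1), (m.choose a : ℚ) / ((q + 1 + a).choose (a + 1) : ℚ))))
      ≤ ∑ a ∈ range (m + 1), (m.choose a : ℚ) / ((q + 3 + a).choose (a + 3) : ℚ) := by
  set S1 := ∑ a ∈ range (m + 1), (m.choose a : ℚ) / ((q + 1 + a).choose (a + 1) : ℚ) with hS1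
  set S2 := ∑ a ∈ range (m + 1), (m.choose a : ℚ) / ((q + 2 + a).choose (a + 2) : ℚ) with hS2
  have hS1pos : 0 < S1 := by
    rw [hS1]
    refine Finset.sum_pos (fun a ha => ?_) ⟨0, by simp⟩
    rw [Finset.mem_range] at ha
    have : (0 : ℚ) < (q + 1 + a).choose (a + 1) := by exact_mod_cast Nat.choose_pos (by omega)
    have : (0 : ℚ) < m.choose a := by exact_mod_cast Nat.choose_pos (by omega)
    positivity
  have hle : S2 ≤ S1 := sliceTwo_le_sliceOne q m
  have hr : S2 / S1 < q + 1 := by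
    have : S2 / S1 ≤ 1 := by rw [div_le_one hS1pos]; exact hle
    have : (1 : ℚ) ≤ q := by exact_mod_cast hq
    linarith
  have h := sliceThree_ge_line q m hq (S2 / S1) hr
  have hcancel : S2 - S2 / S1 * S1 = 0 := by rw [div_mul_cancel₀ _ hS1pos.ne', sub_self]
  rw [hcancel, mul_zero, add_zero] at h
  calc S1 * (S2 / S1 * (1 + ((q : ℚ) - 1) * (S2 / S1)) / ((q : ℚ) + 1 - S2 / S1))
      = S2 / S1 * (1 + ((q : ℚ) - 1) * (S2 / S1)) / ((q : ℚ) + 1 - S2 / S1) * S1 := by ring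
    _ ≤ _ := h

end PercRepro
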